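import Mathlib

/-!
# Route FilamentSkeletonRss · crux `CoreGluing` (stmt-NavierStokesRegularity-15401) — line `Sketch`,
# stub `stub_accretionBudgetZeroMean`: zero net accretion at the stagnation core

Helper file (theorems only) for the skeleton of the crux `CoreGluing`. Along a filament with
tangential material speed `w = Φ'` (one stagnation point, `Φ → +∞` at both ends) the circulation
`κ(τ)` through the cross-sections of an exact steady tube obeys the one-dimensional budget
`κ'' − Φ' κ' = F`, `F` the net sideways vorticity flux. The lemma proved here is the solvability
("zero net accretion") condition: a *bounded* `κ` forces `∫ F e^{−Φ} = 0`.

Proof. With the integrating factor, `ψ := κ' e^{−Φ}` satisfies `ψ' = F e^{−Φ} =: f`, which is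
integrable on `ℝ`; hence `ψ` has finite limits `L₊`, `L₋` at `+∞`, `−∞` and `∫ f = L₊ − L₋`
(`MeasureTheory.integral_of_hasDerivAt_of_tendsto`). If `L₊ > 0` then eventually
`κ' = ψ e^{Φ} ≥ (L₊/2) · 1`, so by the mean value inequality `κ` grows at least linearly,
contradicting `|κ| ≤ M`; the case `L₊ < 0` is the same for `−κ`, and `L₋ = 0` follows by the
reflection `τ ↦ −τ`. Mathlib only.
-/

-- the summit and its single sub-problem share the name (CONVENTIONS §1), as in every Theorems file
set_option linter.dupNamespace false

namespace Summit.NavierStokesRegularity.NavierStokesRegularity.Theorems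

open Set Filter MeasureTheory Topology

/-- Linear growth versus boundedness: there is no function with `|κ| ≤ M` on `ℝ` whose
derivative is eventually `≥ c > 0` at `+∞` (mean value inequality on `[T, T + (2M+1)/c]`). -/
private theorem accretionBudget_false_of_le_deriv {κ κ' : ℝ → ℝ} {M c : ℝ}
    (hM : ∀ τ, |κ τ| ≤ M) (hκ : ∀ τ, HasDerivAt κ (κ' τ) τ) (hc : 0 < c)
    (h : ∀ᶠ τ in atTop, c ≤ κ' τ) : False := by
  obtain ⟨T, hT⟩ := eventually_atTop.1 h
  have hdiff : Differentiable ℝ κ := fun τ => (hκ τ).differentiableAt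
  have hM0 : 0 ≤ M := (abs_nonneg _).trans (hM 0)
  have hTy : T ≤ T + (2 * M + 1) / c := by
    have : 0 ≤ (2 * M + 1) / c := div_nonneg (by linarith) hc.le
    linarith
  have key : c * (T + (2 * M + 1) / c - T) ≤ κ (T + (2 * M + 1) / c) - κ T :=
    (convex_Ici T).mul_sub_le_image_sub_of_le_deriv hdiff.continuous.continuousOn
      hdiff.differentiableOn
      (fun x hx => by
        rw [interior_Ici] at hx
        rw [(hκ x).deriv]
        exact hT x (le_of_lt hx))
      T self_mem_Ici _ hTy hTy
  have h1 : c * (T + (2 * M + 1) / c - T) = 2 * M + 1 := by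
    rw [add_sub_cancel_left, mul_div_cancel₀ _ hc.ne']
  have h2 := hM (T + (2 * M + 1) / c)
  have h3 := hM T
  rw [abs_le] at h2 h3
  linarith [h2.1, h2.2, h3.1, h3.2]

/-- If `κ' = ψ · e^{Φ}` with `κ` bounded, `Φ → +∞` and `ψ → L` along `atTop`, then `L = 0`:
otherwise `κ'` is eventually bounded away from `0` with a fixed sign. -/
private theorem accretionBudget_limit_eq_zero {κ ψ Φ : ℝ → ℝ} {M L : ℝ}
    (hM : ∀ τ, |κ τ| ≤ M) (hκ : ∀ τ, HasDerivAt κ (ψ τ * Real.exp (Φ τ)) τ)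
    (hΦ : Tendsto Φ atTop atTop) (hψ : Tendsto ψ atTop (𝓝 L)) : L = 0 := by
  by_contra hL
  rcases lt_or_gt_of_ne hL with hL | hL
  · have hc : (0 : ℝ) < -L / 2 := by linarith
    refine accretionBudget_false_of_le_deriv (κ := fun τ => -κ τ)
      (κ' := fun τ => -(ψ τ * Real.exp (Φ τ))) (M := M)
      (fun τ => by rw [abs_neg]; exact hM τ) (fun τ => (hκ τ).fun_neg) hc ?_
    filter_upwards [hψ.eventually_le_const (show L < L / 2 by linarith),
      hΦ.eventually_ge_atTop 0] with τ h1 h2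
    have h3 : 1 ≤ Real.exp (Φ τ) := Real.one_le_exp h2
    have : -L / 2 * 1 ≤ -ψ τ * Real.exp (Φ τ) :=
      mul_le_mul (by linarith) h3 zero_le_one (by linarith)
    linarith
  · have hc : (0 : ℝ) < L / 2 := by linarith
    refine accretionBudget_false_of_le_deriv hM hκ hc ?_
    filter_upwards [hψ.eventually_const_le (show L / 2 < L by linarith),
      hΦ.eventually_ge_atTop 0] with τ h1 h2
    have h3 : 1 ≤ Real.exp (Φ τ) := Real.one_le_exp h2
    have : L / 2 * 1 ≤ ψ τ * Real.exp (Φ τ) := mul_le_mul h1 h3 zero_le_one (by linarith)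
    linarith

/-- The same conclusion along `atBot` (with `Φ → +∞` at `−∞`), by the reflection `τ ↦ −τ`. -/
private theorem accretionBudget_limit_eq_zero_atBot {κ ψ Φ : ℝ → ℝ} {M L : ℝ}
    (hM : ∀ τ, |κ τ| ≤ M) (hκ : ∀ τ, HasDerivAt κ (ψ τ * Real.exp (Φ τ)) τ)
    (hΦ : Tendsto Φ atBot atTop) (hψ : Tendsto ψ atBot (𝓝 L)) : L = 0 := by
  have h := accretionBudget_limit_eq_zero (κ := fun τ => κ (-τ)) (ψ := fun τ => -ψ (-τ))
    (Φ := fun τ => Φ (-τ)) (M := M) (L := -L) (fun τ => hM (-τ))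
    (fun τ => ((hκ (-τ)).comp τ (hasDerivAt_neg τ)).congr_deriv (by ring))
    (hΦ.comp tendsto_neg_atTop_atBot) ((hψ.comp tendsto_neg_atTop_atBot).neg)
  linarith

/-- **Zero net accretion at the stagnation core.** If `κ` is bounded and `C²`, `Φ` is `C¹` with
`Φ → +∞` at both ends, `F` is continuous with `F e^{−Φ}` integrable, and the circulation budget
`κ'' − Φ' κ' = F` holds on `ℝ`, then the `e^{−Φ}`-weighted net flux vanishes: `∫ F e^{−Φ} = 0`.
(First lemma of the idea card `zero-accretion-selection`; route `FilamentSkeletonRss`, crux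
`CoreGluing`.) -/
theorem stub_accretionBudgetZeroMean : ∀ (κ Φ F : ℝ → ℝ), (∃ M : ℝ, ∀ τ, |κ τ| ≤ M) → ContDiff ℝ 2 κ → ContDiff ℝ 1 Φ → Continuous F → Tendsto Φ atTop atTop → Tendsto Φ atBot atTop → Integrable (fun τ => F τ * Real.exp (-Φ τ)) → (∀ τ, iteratedDeriv 2 κ τ - deriv Φ τ * deriv κ τ = F τ) → ∫ τ, F τ * Real.exp (-Φ τ) = 0 := by
  intro κ Φ F hM hκ hΦ _hF hΦtop hΦbot hint hODE
  obtain ⟨M, hM⟩ := hM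
  -- first and second derivatives of `κ`, first derivative of `Φ`
  have hκ1 : ∀ τ, HasDerivAt κ (deriv κ τ) τ := fun τ =>
    ((hκ.differentiable (by simp)) τ).hasDerivAt
  have hκ2 : ∀ τ, HasDerivAt (deriv κ) (iteratedDeriv 2 κ τ) τ := fun τ => by
    rw [iteratedDeriv_succ, iteratedDeriv_one]
    exact (hκ.differentiable_deriv_two τ).hasDerivAt
  have hΦ1 : ∀ τ, HasDerivAt Φ (deriv Φ τ) τ := fun τ =>
    ((hΦ.differentiable (by simp)) τ).hasDerivAt
  -- `ψ := κ' e^{-Φ}` has derivative `F e^{-Φ}` (integrating factor + the budget)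
  set ψ : ℝ → ℝ := fun τ => deriv κ τ * Real.exp (-Φ τ) with hψ_def
  have hψ : ∀ τ, HasDerivAt ψ (F τ * Real.exp (-Φ τ)) τ := fun τ => by
    refine ((hκ2 τ).mul (hΦ1 τ).fun_neg.exp).congr_deriv ?_
    rw [← hODE τ]
    ring
  -- hence `ψ` has finite limits at `±∞`, and `∫ F e^{-Φ}` is their difference
  have htop : Tendsto ψ atTop (𝓝 (limUnder atTop ψ)) :=
    tendsto_limUnder_of_hasDerivAt_of_integrableOn_Ioi (a := 0) (fun x _ => hψ x)
      hint.integrableOn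
  have hbot : Tendsto ψ atBot (𝓝 (limUnder atBot ψ)) :=
    tendsto_limUnder_of_hasDerivAt_of_integrableOn_Iic (a := 0) (fun x _ => hψ x)
      hint.integrableOn
  -- `κ' = ψ e^{Φ}` with `κ` bounded and `Φ → +∞` at both ends: both limits vanish
  have hκψ : ∀ τ, HasDerivAt κ (ψ τ * Real.exp (Φ τ)) τ := fun τ => by
    refine (hκ1 τ).congr_deriv ?_
    show deriv κ τ = deriv κ τ * Real.exp (-Φ τ) * Real.exp (Φ τ)
    rw [mul_assoc, ← Real.exp_add, neg_add_cancel, Real.exp_zero, mul_one]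
  have h1 : limUnder atTop ψ = 0 := accretionBudget_limit_eq_zero hM hκψ hΦtop htop
  have h2 : limUnder atBot ψ = 0 := accretionBudget_limit_eq_zero_atBot hM hκψ hΦbot hbot
  rw [integral_of_hasDerivAt_of_tendsto hψ hint hbot htop, h1, h2, sub_zero]

end Summit.NavierStokesRegularity.NavierStokesRegularity.Theorems
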